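import Summits.BirchSwinnertonDyer.Rank1Residual.X5.TwoAdicTargetsTowerGapEnd
import Summits.BirchSwinnertonDyer.Rank1Residual.X5.TwoAdicTargetsAlpha
import HarnessLib

/-!
# Class O1 (X5, `p = 2`, non-CM), seat `bsd-2adic-ord` (Kato at ordinary `2`): the tower-gap
# certificate IS `X` torsion `∧ μ = 0`; Greenberg Prop. 5.14 discharges `TowerGapAtTwo` and the
# Néron-integral Kato divisibility `MainConjectureLowerDivisibilityAtTwoOrd`; Prop. 5.13 refutes the
# certificate on the ramified-AND-odd locus

HONEST FRAMING (cell `bsd-2adic`, run/shared/lean/pub/bsd-2adic/, HUMAN RULING D-0036): this file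
PROVES bookkeeping theorems about two typed targets of the O1 class-closure lane and asserts NO new
fact. Every deep input enters as a hypothesis that is a PUBLISHED named fact of the tree
(`kato_divisibility_allPrimes W 2` = Kato 2004 Thm. 17.4 (1)(2) read at `p = 2`;
`prop514_isTorsion_mu_eq_zero_two` / `prop513_one_le_mu_two_of_ramified_odd` = Greenberg LNM 1716
Props. 5.14 / 5.13) or a per-curve certificate (`hint`: `ϖ · L₂(f, α) ∈ Λ`). Nothing is booked; no
count of record moves; O1 stays OPEN.

## What is proved (theorems only; 0 definitions; 0 named facts)

* **Part A (pure `Λ`-algebra, any prime `p`, namespace `…X5.TowerGap`).** The converse of the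
  tower-gap lemma of `X5/TwoAdicTargetsTowerGap{,End}.lean`: for a finitely generated
  `Λ = ℤ_p⟦T⟧`-module `X`, `X` torsion `∧ μ(X) = 0 ⇒ X/pX` finite (`X` is then finitely generated over
  `ℤ_p`, tree `muInvariant_eq_zero_iff_finite`; a finitely generated `ℤ_p`-module killed by `p` is
  finite) `⇒` ONE gap `#(X/(p,T^{0+k})X) < p^k · #(X/(p,T^0)X)` with `k = #(X/pX)` (the layer
  quotients are quotients of `X/pX`, and `X/(p, T^0)X = 0`). Hence
  `exists_card_quotient_lt_iff_isTorsion_and_mu_eq_zero`: the certificate shape of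
  `O1.TowerGapAtTwo` is EQUIVALENT to "`X` torsion `∧ μ = 0`" — it is not weaker, not stronger.
* **Part B (`p = 2`, namespace `…X5.O1`).**
  `towerGapAtTwo_iff_isTorsion_and_mu_eq_zero` (the typed item `O1.TowerGapAtTwo W` ⟺ for every
  cyclotomic datum `X(E/ℚ_∞)` is `Λ`-torsion with `μ₂ = 0`);
  `towerGapAtTwo_of_prop514` (Greenberg Prop. 5.14 AT `2`, PRINT, named fact as hypothesis: a
  good-ordinary-`2` curve with a rational point of order `2` that is ramified-at-`2` XOR odd satisfies
  `TowerGapAtTwo W` — the α-go habitat, 83 of the 611 good-ordinary O1 residue classes of record);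
  `not_towerGapAtTwo_of_prop513` (Prop. 5.13 AT `2`, PRINT: a ramified-AND-odd rational point of
  order `2` makes `TowerGapAtTwo W` FALSE — so the item cannot be discharged class-wide as typed;
  `BSD(E,2)` being an isogeny-class statement, the lane moves to an isogenous Prop-5.14 member where
  one exists); `mainConjectureLowerDivisibilityAtTwoOrd_of_towerGapAtTwo` and
  `mainConjectureLowerDivisibilityAtTwoOrd_of_prop514` (the typed item
  `O1.MainConjectureLowerDivisibilityAtTwoOrd W` — Kato's divisibility `char_Λ X ∣ ϖ·L₂(f,α)` in `Λ`,
  Néron normalisation, KATO direction per `X5/TwoAdicTargetsAlpha.lean` ORIENTATION — follows from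
  Kato 17.4 (1)(2)@2 + the tower-gap certificate (resp. Prop. 5.14) + the Néron-integrality
  certificate `hint`, via the refuter's `μ = 0` upgrade `charIdeal_dvd_of_towerGap`).

## Why (the seat's reading of Kato at `p = 2`, first-hand, Astérisque 295)

Thm. 12.5 (3) (p. 222) bounds `length_{Λ_𝔭} H²` at EVERY height-one prime `𝔭 ∌ p` with NO parity
and NO image hypothesis; Thm. 12.5 (4) (all `𝔭`, integral) assumes `p ≠ 2` AND (12.5.2); the parity
enters through Thm. 13.4 (3) (p. 226, the Euler-system bound at `𝔭 = (p)`, quoted from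
[Pe4, Ru4, KK4]); Conj. 12.10 itself excludes `𝔭 ∋ 2`. Hence at a good ordinary `2` the ONLY clause of
Kato's divisibility not in print is the `𝔭 = (2)` clause "`μ(X(E/ℚ_∞)) ≤ μ(ϖ·L₂(E))`"; the
'explicit finite error term' `n` in `char X ∣ 2ⁿ·ϖ·L₂` is `n = μ(X) − μ(ϖ L₂)` when positive
(`MuZeroUpgrade.C_pow_mul_mem_charIdeal_iff_mu_le`), and it VANISHES wherever `μ(X) = 0` — which is
exactly what the tower-gap certificate / Prop. 5.14 supply. This file records that equivalence at
the level of the typed items.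

References: K. Kato, Astérisque 295 (2004), Thm. 12.5 (pp. 221–222), Thm. 13.4 (p. 226),
Conj. 12.10 (p. 224), Thm. 17.4 (p. 273); R. Greenberg, LNM 1716 (1999), Props. 5.13–5.14
(pp. 120–121), Conj. 1.11; L. Washington, *Introduction to Cyclotomic Fields*, §13.2;
K. Matsuno, IJNT 4 (2008), Prop. 6.2 and its Remark (17A2: `μ = 1`, `λ = 0`).
-/

set_option autoImplicit false

noncomputable section

open scoped Classical MatrixGroups ModularForm Pointwise

open CongruenceSubgroup WeierstrassCurve Literature.NumberTheory.EllipticCurves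
  Literature.NumberTheory.EllipticCurves.ModularForms
  Literature.NumberTheory.EllipticCurves.Rank1Residual
  Literature.NumberTheory.EllipticCurves.Rank1Residual.Typed
  Literature.NumberTheory.EllipticCurves.Greenberg1999
  IsLocalRing

/-! ## Part A — the converse of the tower-gap lemma (any prime `p`) -/

namespace Summit.BirchSwinnertonDyer.Rank1Residual.X5.TowerGap

variable (p : ℕ) [hp : Fact p.Prime] {M : Type*} [AddCommGroup M] [Module (IwasawaAlgebra p) M]

/-- `(p, T^0) = Λ`. [folklore] -/
theorem towerIdeal_zero : towerIdeal p 0 = ⊤ := by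
  rw [towerIdeal, pow_zero, Ideal.one_eq_top, sup_top_eq]

/-- `X/(p, T^0)X = 0` has exactly one element. [folklore] -/
theorem natCard_quotient_towerIdeal_zero :
    Nat.card (M ⧸ (towerIdeal p 0 • ⊤ : Submodule (IwasawaAlgebra p) M)) = 1 := by
  rw [towerIdeal_zero, Submodule.top_smul]
  exact Nat.card_unique

/-- Every layer quotient `X/(p, T^k)X` is a quotient of `X/pX`, so (when `X/pX` is finite)
`#(X/(p, T^k)X) ≤ #(X/pX)`. [folklore] -/
theorem natCard_quotient_towerIdeal_le_natCard_quotient_modP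
    (hfin : Finite (M ⧸ modPSubmodule p M)) (k : ℕ) :
    Nat.card (M ⧸ (towerIdeal p k • ⊤ : Submodule (IwasawaAlgebra p) M)) ≤
      Nat.card (M ⧸ modPSubmodule p M) := by
  rw [natCard_quotient_eq_index, natCard_quotient_eq_index]
  have hle : (modPSubmodule p M).toAddSubgroup ≤
      (towerIdeal p k • ⊤ : Submodule (IwasawaAlgebra p) M).toAddSubgroup := fun x hx =>
    (Submodule.smul_mono_left (le_sup_left :
      Ideal.span {(PowerSeries.C (p : ℤ_[p]) : IwasawaAlgebra p)} ≤ towerIdeal p k) :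
      modPSubmodule p M ≤ (towerIdeal p k • ⊤ : Submodule (IwasawaAlgebra p) M)) hx
  have hpos : 0 < (modPSubmodule p M).toAddSubgroup.index := by
    rw [← natCard_quotient_eq_index]
    exact Nat.card_pos
  exact Nat.le_of_dvd hpos (AddSubgroup.index_dvd_of_le hle)

/-- **`X/pX` finite ⇒ a tower gap** (the converse of `finite_modP_of_card_quotient_lt`): with
`m = 0` and `k = #(X/pX)`, `#(X/(p, T^{0+k})X) ≤ #(X/pX) < p^{#(X/pX)} = p^k · #(X/(p, T^0)X)`.
[folklore] -/
theorem exists_card_quotient_lt_of_finite_modP (hfin : Finite (M ⧸ modPSubmodule p M)) :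
    ∃ m k : ℕ, Nat.card (M ⧸ (towerIdeal p (m + k) • ⊤ : Submodule (IwasawaAlgebra p) M)) <
      p ^ k * Nat.card (M ⧸ (towerIdeal p m • ⊤ : Submodule (IwasawaAlgebra p) M)) := by
  refine ⟨0, Nat.card (M ⧸ modPSubmodule p M), ?_⟩
  rw [zero_add, natCard_quotient_towerIdeal_zero, mul_one]
  exact (natCard_quotient_towerIdeal_le_natCard_quotient_modP p hfin _).trans_lt
    (Nat.lt_pow_self hp.out.one_lt)

section PadicInt

variable [Module ℤ_[p] M] [IsScalarTower ℤ_[p] (IwasawaAlgebra p) M]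

/-- **`X` finitely generated over `ℤ_p ⇒ X/pX` finite**: `X/pX` is a finitely generated module over
the finite ring `ℤ_p/(p) ≅ 𝔽_p`. [cite: Washington1997, §13.2] -/
theorem finite_modP_of_moduleFinite_padicInt [Module.Finite ℤ_[p] M] :
    Finite (M ⧸ modPSubmodule p M) := by
  -- the quotient carries the inherited `ℤ_p`-structure (`Submodule.Quotient.module'`)
  haveI : Module.Finite ℤ_[p] (M ⧸ modPSubmodule p M) :=
    Module.Finite.quotient ℤ_[p] (modPSubmodule p M)
  -- `X/pX` is killed by `p`
  have hQ : ∀ q : M ⧸ modPSubmodule p M, ((p : ℤ_[p]) ^ 1) • q = 0 := fun q => by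
    rw [pow_one]
    induction q using Submodule.Quotient.induction_on with
    | H x =>
      rw [← Submodule.Quotient.mk_smul, Submodule.Quotient.mk_eq_zero, padicInt_smul_eq_C_smul]
      exact Submodule.smul_mem_smul (Ideal.mem_span_singleton_self _) Submodule.mem_top
  -- hence a finitely generated module over the finite ring `ℤ_p/(p)`
  set 𝔞 : Ideal ℤ_[p] := Ideal.span {((p : ℤ_[p])) ^ 1} with h𝔞
  have hT : Module.IsTorsionBySet ℤ_[p] (M ⧸ modPSubmodule p M) 𝔞 := by
    rintro q ⟨a, ha⟩
    obtain ⟨c, rfl⟩ := Ideal.mem_span_singleton'.1 ha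
    change (c * (p : ℤ_[p]) ^ 1) • q = 0
    rw [mul_smul, hQ, smul_zero]
  letI : Module (ℤ_[p] ⧸ 𝔞) (M ⧸ modPSubmodule p M) := hT.module
  haveI : IsScalarTower ℤ_[p] (ℤ_[p] ⧸ 𝔞) (M ⧸ modPSubmodule p M) := hT.isScalarTower
  haveI : Module.Finite (ℤ_[p] ⧸ 𝔞) (M ⧸ modPSubmodule p M) :=
    Module.Finite.of_restrictScalars_finite ℤ_[p] _ _
  haveI : Finite (ℤ_[p] ⧸ 𝔞) := by
    have e : ℤ_[p] ⧸ RingHom.ker (PadicInt.toZModPow 1) ≃+* ZMod (p ^ 1) :=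
      RingHom.quotientKerEquivOfSurjective (ZMod.ringHom_surjective (PadicInt.toZModPow 1))
    rw [h𝔞, ← PadicInt.ker_toZModPow]
    exact Finite.of_equiv _ e.toEquiv.symm
  exact Module.finite_of_finite (ℤ_[p] ⧸ 𝔞)

end PadicInt

/-- **`X` torsion with `μ(X) = 0 ⇒ X/pX` finite** for `X` finitely generated over `Λ` (`μ = 0 ⟺`
f.g. over `ℤ_p` for f.g. torsion `X`, tree `muInvariant_eq_zero_iff_finite`, Washington §13.2;
the `ℤ_p`-structure is the restricted one). [cite: Washington1997, §13.2] -/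
theorem finite_modP_of_isTorsion_of_mu_eq_zero [Module.Finite (IwasawaAlgebra p) M]
    (hT : Module.IsTorsion (IwasawaAlgebra p) M) (hμ : muInvariant p M = 0) :
    Finite (M ⧸ modPSubmodule p M) := by
  letI : Module ℤ_[p] M := Module.compHom M (algebraMap ℤ_[p] (IwasawaAlgebra p))
  haveI : IsScalarTower ℤ_[p] (IwasawaAlgebra p) M := IsScalarTower.of_compHom ℤ_[p] _ M
  haveI : Module.Finite ℤ_[p] M := (muInvariant_eq_zero_iff_finite p M hT).mp hμ
  exact finite_modP_of_moduleFinite_padicInt p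

/-- **`X/pX` finite ⟺ `X` torsion `∧ μ(X) = 0`** for `X` finitely generated over `Λ = ℤ_p⟦T⟧`
(Greenberg–Vatsal 2000 Prop. (2.8) shape; Washington §13.2). [cite: Washington1997, §13.2]
[cite: GreenbergVatsal2000, §2 Prop. (2.8) (p. 25)] -/
theorem finite_modP_iff_isTorsion_and_mu_eq_zero [Module.Finite (IwasawaAlgebra p) M] :
    Finite (M ⧸ modPSubmodule p M) ↔
      Module.IsTorsion (IwasawaAlgebra p) M ∧ muInvariant p M = 0 :=
  ⟨isTorsion_and_mu_eq_zero_of_finite_modP p,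
    fun h => finite_modP_of_isTorsion_of_mu_eq_zero p h.1 h.2⟩

/-- **The tower-gap certificate shape is EQUIVALENT to `X` torsion `∧ μ(X) = 0`** for `X` finitely
generated over `Λ`: `(∃ m k, #(X/(p,T^{m+k})X) < p^k · #(X/(p,T^m)X)) ⟺ X` torsion `∧ μ(X) = 0`.
(⇒) is `isTorsion_and_mu_eq_zero_of_card_quotient_lt` (`X5/TwoAdicTargetsTowerGapEnd.lean`);
(⇐) is `exists_card_quotient_lt_of_finite_modP`. [cite: Washington1997, §13.2] -/
theorem exists_card_quotient_lt_iff_isTorsion_and_mu_eq_zero [Module.Finite (IwasawaAlgebra p) M] :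
    (∃ m k : ℕ, Nat.card (M ⧸ (towerIdeal p (m + k) • ⊤ : Submodule (IwasawaAlgebra p) M)) <
      p ^ k * Nat.card (M ⧸ (towerIdeal p m • ⊤ : Submodule (IwasawaAlgebra p) M))) ↔
      Module.IsTorsion (IwasawaAlgebra p) M ∧ muInvariant p M = 0 :=
  ⟨fun ⟨m, k, h⟩ => isTorsion_and_mu_eq_zero_of_card_quotient_lt p m k h,
    fun h => exists_card_quotient_lt_of_finite_modP p
      (finite_modP_of_isTorsion_of_mu_eq_zero p h.1 h.2)⟩

end Summit.BirchSwinnertonDyer.Rank1Residual.X5.TowerGap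

/-! ## Part B — the O1 items at `p = 2` -/

namespace Summit.BirchSwinnertonDyer.Rank1Residual.X5.O1

open Summit.BirchSwinnertonDyer.Rank1Residual.X5.TowerGap

variable (W : WeierstrassCurve ℚ) [W.IsElliptic] [W.IsGloballyMinimal]

omit [W.IsGloballyMinimal] in
/-- **`O1.TowerGapAtTwo W` ⟺ for every cyclotomic datum, `X(E/ℚ_∞)` is `Λ`-torsion with
`μ₂ = 0`.** (⇒) is T10 (`isTorsion_and_mu_eq_zero_of_towerGapAtTwo`); (⇐) is Part A
(`X` is finitely generated for an elliptic curve, `module_finite_holds`). So the typed certificate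
item is EXACTLY Greenberg's "`Sel_E(ℚ_∞)₂` is `Λ`-cotorsion and `μ_E = 0`" for the cyclotomic data —
no more, no less. [cite: GreenbergLNM1716, §1 Conj. 1.11 and Prop. 5.14 (p. 121)]
[cite: Washington1997, §13.2] -/
theorem towerGapAtTwo_iff_isTorsion_and_mu_eq_zero :
    TowerGapAtTwo W ↔
      ∀ (κ : ZpExtension ℚ 2) (γ : Field.absoluteGaloisGroup ℚ), κ.IsCyclotomic →
        κ.IsTopGenerator γ → IsCyclotomicVariable 2 γ → ∀ D : W.SelmerDualData κ γ,
        D.IsTorsion ∧ D.mu = 0 := by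
  refine ⟨fun h κ γ hκ hγ hγ' D => isTorsion_and_mu_eq_zero_of_towerGapAtTwo W h hκ hγ hγ' D,
    fun h κ γ hκ hγ hγ' D => ?_⟩
  haveI : Module.Finite (IwasawaAlgebra 2) D.X := D.module_finite_holds hγ
  obtain ⟨hT, hμ⟩ := h κ γ hκ hγ hγ' D
  exact exists_card_quotient_lt_of_finite_modP 2 (finite_modP_of_isTorsion_of_mu_eq_zero 2 hT hμ)

/-- **`TowerGapAtTwo W` DISCHARGED on the α-go habitat, modulo PRINT**: a good-ordinary-`2` curve
with a rational point `(x, y)` of order `2` that is ramified-at-`2` XOR odd satisfies the tower-gap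
certificate for every cyclotomic datum — Greenberg LNM 1716 Prop. 5.14 at `2` (named fact
`prop514_isTorsion_mu_eq_zero_two`, hypothesis `h514`) + the converse gap lemma. (Habitat of
record: 83 of the 611 good-ordinary O1 residue classes contain such a member — refuter census
`O1D-GREENBERG-L1.tsv`, EVIDENCE, not used here.) [cite: GreenbergLNM1716, Prop. 5.14 (p. 121; held copy chunk p0170)] -/
theorem towerGapAtTwo_of_prop514 (h514 : prop514_isTorsion_mu_eq_zero_two) (hgo : GoodOrd W 2)
    {x y : ℚ} (hP : W.toAffine.Equation x y) (h2 : 2 * y + W.a₁ * x + W.a₃ = 0)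
    (hΦ : (TwoTorsionRamifiedAtTwo x ∧ ¬ TwoTorsionOdd W x) ∨
      (TwoTorsionOdd W x ∧ ¬ TwoTorsionRamifiedAtTwo x)) :
    TowerGapAtTwo W :=
  (towerGapAtTwo_iff_isTorsion_and_mu_eq_zero W).mpr fun _ _ hκ hγ _ D =>
    isTorsion_and_mu_eq_zero_of_prop514 W h514 hgo hP h2 hΦ hκ hγ D

/-- **`TowerGapAtTwo W` is FALSE on the ramified-AND-odd locus, modulo PRINT** (Greenberg LNM 1716
Prop. 5.13 at `2`, `m = 1`, named fact `prop513_one_le_mu_two_of_ramified_odd`, hypothesis `h513`):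
a curve with good-ordinary or multiplicative reduction at `2` and a rational point of order `2` that
is ramified at `2` AND odd has `μ(X(E/ℚ_∞)) ≥ 1` for the cyclotomic datum (which exists:
`exists_isCyclotomic_isTopGenerator_isCyclotomicVariable_holds`, `nonempty_selmerDualData_holds`),
contradicting T10. So the typed certificate item cannot be discharged CLASS-WIDE as stated: on such
a curve (Greenberg: "examples where `μ_E > 0` are abundant"; e.g. conductor `15`, the curves with
`x(P) ∈ {−13/4, 3/4, −29/4, 51/4, −109/4}`, seat STEP-0 job j239548) the Kato-side route must pass to
an isogenous Prop-5.14 member (`BSD(E,2)` is an isogeny-class statement, `bsdp_two_iff_of_isIsogenous`).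
[cite: GreenbergLNM1716, Prop. 5.13 (p. 120; held copy chunk p0168) and the Remark (chunk p0170)] -/
theorem not_towerGapAtTwo_of_prop513 (h513 : prop513_one_le_mu_two_of_ramified_odd)
    (hred : GoodOrd W 2 ∨ W.HasMultiplicativeReductionAtPrime 2)
    {x y : ℚ} (hP : W.toAffine.Equation x y) (h2 : 2 * y + W.a₁ * x + W.a₃ = 0)
    (hram : TwoTorsionRamifiedAtTwo x) (hodd : TwoTorsionOdd W x) : ¬ TowerGapAtTwo W := by
  intro hgap
  obtain ⟨κ, hκ, γ, hγ, hγ'⟩ := exists_isCyclotomic_isTopGenerator_isCyclotomicVariable_holds 2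
  obtain ⟨D⟩ := W.nonempty_selmerDualData_holds κ γ hγ
  obtain ⟨hT, hμ⟩ := isTorsion_and_mu_eq_zero_of_towerGapAtTwo W hgap hκ hγ hγ' D
  exact prop513_one_le_mu_two_of_ramified_odd.mu_ne_zero h513 W hred hP h2 hram hodd hκ hγ D hT hμ

/-- **`O1.MainConjectureLowerDivisibilityAtTwoOrd W` from the tower-gap certificate, modulo
PRINT + ONE certificate.** Hypotheses: Kato 17.4 (1)(2) AT `2` for the newform (`h17`, named fact
`kato_divisibility_allPrimes W 2`: `X` torsion and `char_Λ X ∣ 2ⁿ·L₂(f,α)` — Astérisque 295 Thm. 12.5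
(3) / 17.4 (2) carry no parity hypothesis at the height-one primes `𝔭 ∌ 2`), the Néron-integrality
certificate `hint` (`ϖ·L₂(f,α) = ι L₀`, `L₀ ∈ Λ`), and `TowerGapAtTwo W` (`μ₂ = 0`, T10). Conclusion:
the typed item — `∃ g ∈ char_Λ X, ι g = ϖ·L₂(f,α)`, i.e. `char_Λ X(E/ℚ_∞) ∣ ϖ·L₂(E)` in `Λ`, the
`𝔭 = (2)` clause included — via the refuter's upgrade `charIdeal_dvd_of_towerGap`. This is the
'explicit finite error term' statement of the seat's brief with error term ZERO on the `μ = 0` locus.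
[cite: Kato2004Asterisque, Thm. 12.5 (3) (p. 222) and Thm. 17.4 (1)(2) (p. 273)]
[cite: GreenbergVatsal2000, p. 4 (after Thm. (1.2))] -/
theorem mainConjectureLowerDivisibilityAtTwoOrd_of_towerGapAtTwo
    (h17 : ∀ [NeZero (W.conductorNorm ℤ)] (f : CuspForm (Gamma0 (W.conductorNorm ℤ)) 2),
      kato_divisibility_allPrimes W 2 (f := f))
    (hint : ∀ [NeZero (W.conductorNorm ℤ)] (f : CuspForm (Gamma0 (W.conductorNorm ℤ)) 2),
      IsNewformOf W f → ∀ ϖ : ℚ, (ϖ : ℝ) * W.realPeriodRat = plusPeriod f →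
        ∃ L₀ : IwasawaAlgebra 2, iwasawaToPowerSeries 2 L₀ =
          PowerSeries.C (ϖ : ℚ_[2]) * padicLFunction f (unitRoot W 2 : ℚ_[2]))
    (hgap : TowerGapAtTwo W) : MainConjectureLowerDivisibilityAtTwoOrd W := by
  intro κ γ hκ hγ hγ' hord _ f hf ϖ hϖ D
  obtain ⟨L₀, hL₀⟩ := hint f hf ϖ hϖ
  exact ⟨L₀, (charIdeal_dvd_of_towerGap W hgap hord (h17 f) hκ hγ hγ' hf D hL₀).2, hL₀⟩

/-- **BOTH typed targets of the seat's brief on the α-go habitat, modulo PRINT + ONE certificate**: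
on a good-ordinary-`2` curve with a ramified-XOR-odd rational point of order `2`, Greenberg Prop. 5.14
AT `2` (`h514`), Kato 17.4 (1)(2) AT `2` (`h17`) and the Néron-integrality certificate (`hint`) give
`TowerGapAtTwo W ∧ MainConjectureLowerDivisibilityAtTwoOrd W`. What this is NOT: not a class-wide
theorem (Prop. 5.13 locus: `not_towerGapAtTwo_of_prop513`; `E[2]` irreducible: `μ₂ = 0` is
Greenberg's Conj. 1.11 at `2`, OPEN); not the Eisenstein (lower, Skinner–Urban) half; not `BSD(E,2)`.
[cite: GreenbergLNM1716, Prop. 5.14 (p. 121)] [cite: Kato2004Asterisque, Thm. 17.4 (1)(2) (p. 273)] -/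
theorem towerGapAtTwo_and_mainConjectureLowerDivisibilityAtTwoOrd_of_prop514
    (h514 : prop514_isTorsion_mu_eq_zero_two)
    (h17 : ∀ [NeZero (W.conductorNorm ℤ)] (f : CuspForm (Gamma0 (W.conductorNorm ℤ)) 2),
      kato_divisibility_allPrimes W 2 (f := f))
    (hint : ∀ [NeZero (W.conductorNorm ℤ)] (f : CuspForm (Gamma0 (W.conductorNorm ℤ)) 2),
      IsNewformOf W f → ∀ ϖ : ℚ, (ϖ : ℝ) * W.realPeriodRat = plusPeriod f →
        ∃ L₀ : IwasawaAlgebra 2, iwasawaToPowerSeries 2 L₀ =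
          PowerSeries.C (ϖ : ℚ_[2]) * padicLFunction f (unitRoot W 2 : ℚ_[2]))
    (hgo : GoodOrd W 2) {x y : ℚ} (hP : W.toAffine.Equation x y)
    (h2 : 2 * y + W.a₁ * x + W.a₃ = 0)
    (hΦ : (TwoTorsionRamifiedAtTwo x ∧ ¬ TwoTorsionOdd W x) ∨
      (TwoTorsionOdd W x ∧ ¬ TwoTorsionRamifiedAtTwo x)) :
    TowerGapAtTwo W ∧ MainConjectureLowerDivisibilityAtTwoOrd W :=
  have hgap := towerGapAtTwo_of_prop514 W h514 hgo hP h2 hΦ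
  ⟨hgap, mainConjectureLowerDivisibilityAtTwoOrd_of_towerGapAtTwo W h17 hint hgap⟩

end Summit.BirchSwinnertonDyer.Rank1Residual.X5.O1

end
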